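import Literature.AlgebraicGeometry.Motives.AbelianVarietyInducedActionMackey
import HarnessLib

/-!
# Intertwining numbers of induced actions on abelian varieties: `ℓ`-adic Frobenius reciprocity
# `rk Hom_{ℤ_ℓ[G]}(T_ℓ Ind_H^G Y, T_ℓ Z) = rk Hom_{ℤ_ℓ[H]}(T_ℓ Y, T_ℓ Res Z)` and Mackey's formula
# `|H| |H'| ⟨χ_{Ind Y}, χ_{Ind Y'}⟩ = Σ_x Σ_{h' ∈ H', xh'x⁻¹ ∈ H} χ_Y(x h'⁻¹ x⁻¹) χ_{Y'}(h')` (Serre Prop. 23's `Σ_s d_s`)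

`X = ⊕_{t ∈ T} Y_t = Ind_H^G (Y, α)` is an induced action on a power of an abelian variety over a field `K` (bicone `b`,
`Σ_t π_t ≫ ι_t = 𝟙`; `ρ : G → End X` with `ι_t ρ(g) π_u = 0` for `u ≠ g t`; `T` transitive, `H = Stab(t₀)`,
`α(h) = ι_{t₀} ρ(h) π_{t₀}`; `Motives/AbelianVarietyInducedAction`), `G` finite, `ℓ` a prime invertible in `K`,
`χ_X(g) = Tr(ρ(g) | T_ℓ X)`.  The tree's `Motives/AbelianVarietyEquivariantHomCharacterBound` gives the INTERTWINING NUMBER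
`|G| · rk_{ℤ_ℓ} Hom_{ℤ_ℓ[G]}(T_ℓ X, T_ℓ Z) = Σ_g χ_Z(g) χ_X(g⁻¹)` (`= |G| ⟨χ_X, χ_Z⟩`) and the bound `rk_ℤ Hom_G(X, Z) ≤ rk_{ℤ_ℓ}
Hom_{ℤ_ℓ[G]}(T_ℓ X, T_ℓ Z)`.  This file evaluates these numbers for induced actions (theorems only):

* §1 **FROBENIUS RECIPROCITY FOR INTERTWINING NUMBERS**: for any `G`-action `ρ_Z` on `Z`,
  **`|H| · Σ_g χ_Z(g) χ_X(g⁻¹) = |G| · Σ_{h ∈ H} χ_Z(h) χ_Y(h⁻¹)`** (`⟨Ind_H^G χ_Y, χ_Z⟩_G = ⟨χ_Y, Res_H χ_Z⟩_H`, Thm. 13, from the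
  prequel's reciprocity against the class function `g ↦ χ_Z(g⁻¹)`), whence
  **`rk Hom_{ℤ_ℓ[G]}(T_ℓ Ind_H^G Y, T_ℓ Z) = rk Hom_{ℤ_ℓ[H]}(T_ℓ Y, T_ℓ Res_H Z)`** and
  **`rk Hom_{ℤ_ℓ[G]}(T_ℓ Z, T_ℓ Ind_H^G Y) = rk Hom_{ℤ_ℓ[H]}(T_ℓ Res_H Z, T_ℓ Y)`** (the `ℓ`-adic companions of the
  `Hom_G`-statements of `Motives/AbelianVarietyInducedActionReciprocity`);
* §2 **MACKEY'S INTERTWINING FORMULA** for two induced actions `X = Ind_H^G (Y, α)` over `T ∋ t₀`, `X' = Ind_{H'}^G (Y', α')`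
  over `T' ∋ t₀'`: **`|H| · |H'| · Σ_g χ_{X'}(g) χ_X(g⁻¹) = |G| · Σ_{x ∈ G} Σ_{h' ∈ H', (xh'x⁻¹) t₀ = t₀} Tr(ι_{t₀} ρ(x h'⁻¹ x⁻¹) π_{t₀} | T_ℓ Y) · Tr(α'(h') | T_ℓ Y')`**
  (§1 with `Z = X'`, then the prequel's Mackey formula for `Res_H X'`), i.e.
  **`|H| |H'| · rk Hom_{ℤ_ℓ[G]}(T_ℓ X, T_ℓ X') = Σ_x Σ_{h' ∈ H' ∩ x⁻¹Hx} χ_Y(x h'⁻¹ x⁻¹) χ_{Y'}(h')`** =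
  `Σ_{s ∈ H\G/H'} |HsH'| ⟨Res ρ^{s}, ρ'⟩_{H' ∩ s⁻¹Hs}`, and for `X' = X` Serre's **`⟨V, V⟩_G = Σ_{s ∈ H\G/H} d_s`**:
  `|H|² · rk End_{ℤ_ℓ[G]}(T_ℓ Ind_H^G Y) = Σ_x Σ_{h ∈ H ∩ x⁻¹Hx} χ_Y(x h⁻¹ x⁻¹) χ_Y(h)` (Prop. 23: `V` is irreducible iff
  `d_1 = 1` and `d_s = 0` for `s ∉ H`).

Scope (stated, not hidden): the ranks are those of `ℤ_ℓ[G]`-equivariant maps of TATE MODULES; the integral rank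
`rk_ℤ Hom_G(X, X')` is only bounded above by them (Tate's conjecture is not asserted), cf. the tree's `finrank_equivariantHom_le`.

## References

* [SerreLinearRepresentations1977] J.-P. Serre, *Linear Representations of Finite Groups*, GTM 42 (1977): §7.2 Thm. 13
  (Frobenius reciprocity `⟨ψ, Res φ⟩_H = ⟨Ind ψ, φ⟩_G`) and Remark (3), §7.3 Prop. 22, §7.4 Prop. 23 and its proof
  ("`⟨V, V⟩_G = ⟨W, Res_H V⟩_H = Σ_{s ∈ H\G/H} d_s`, `d_s = ⟨Res_s(ρ), ρ^s⟩_{H_s}`") and Cor.  Held: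
  `book:serre1977-linear-representations-finite-groups`, PDF pp. 50–54 read 2026-08-28.
* [MumfordAV1970] D. Mumford, *Abelian Varieties* (1970), §19 Thm. 3 (p. 176: `ℤ_ℓ ⊗ Hom(X, Y) ↪ Hom(T_ℓ X, T_ℓ Y)`), Thm. 4 (p. 180).
* [Milne1986AbelianVarieties] J. S. Milne, *Abelian Varieties* (1986), Lemma 12.2, Thm. 12.5 (pp. 189–190).
* [DokchitserEtAl2022] V. Dokchitser, H. Green, A. Konstantinou, A. Morgan, *Parity of ranks of Jacobians of curves*,
  arXiv:2211.06357, §3.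
-/

noncomputable section

open CategoryTheory CategoryTheory.Limits MulAction
open Literature.NumberTheory.DiophantineGeometry

universe u

namespace Literature.AlgebraicGeometry.Motives

namespace AbelianVariety

namespace Imprimitive

variable {K : Type u} [Field K]

/-! ## §1 Frobenius reciprocity for `ℓ`-adic intertwining numbers -/

section Reciprocity

variable (ℓ : ℕ) [Fact ℓ.Prime] {Y Z : AbelianVariety K} {T : Type} [Fintype T] (b : Bicone (fun _ : T ↦ Y))
  {G : Type} [Group G] [Fintype G] [MulAction G T] [IsPretransitive G T] (ρ : G →* End b.pt) (ρZ : G →* End Z)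
  (t₀ : T) [Fintype (stabilizer G t₀)] (α : stabilizer G t₀ →* End Y)

/-- **`⟨Ind_H^G χ_Y, χ_Z⟩_G = ⟨χ_Y, Res_H χ_Z⟩_H`, `ℓ`-adically**: for any action `ρ_Z : G → End Z`,
**`|H| · Σ_{g ∈ G} χ_Z(g) χ_X(g⁻¹) = |G| · Σ_{h ∈ H} χ_Z(h) χ_Y(h⁻¹)`** with `χ_X(g) = Tr(ρ(g) | T_ℓ X)`, `χ_Y(h) = Tr(α(h) | T_ℓ Y)`
(`T` transitive, `H = Stab(t₀)`, `α(h) = ι_{t₀} ρ(h) π_{t₀}`, `ℓ` invertible in `K`): the prequel's Frobenius reciprocity against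
the class function `g ↦ χ_Z(g⁻¹)`. [cite: SerreLinearRepresentations1977, §7.2 Thm. 13] [cite: MumfordAV1970, §19 Thm. 4 (p. 180)] -/
theorem card_stabilizer_mul_sum_trace_mul_trace_inv_eq (hb : ∑ t, b.π t ≫ b.ι t = 𝟙 b.pt)
    (hρ : ∀ (g : G) (t u : T), g • t ≠ u → b.ι t ≫ End.asHom (ρ g) ≫ b.π u = 0) (hℓ : (ℓ : K) ≠ 0)
    (hα : ∀ h : stabilizer G t₀, End.asHom (α h) = b.ι t₀ ≫ End.asHom (ρ h) ≫ b.π t₀) :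
    (Fintype.card (stabilizer G t₀) : ℤ_[ℓ]) *
        ∑ g, LinearMap.trace ℤ_[ℓ] (Z.tateModule ℓ) (tateModuleMap ℓ (End.asHom (ρZ g))) *
          LinearMap.trace ℤ_[ℓ] (b.pt.tateModule ℓ) (tateModuleMap ℓ (End.asHom (ρ g⁻¹))) =
      (Fintype.card G : ℤ_[ℓ]) *
        ∑ h : stabilizer G t₀, LinearMap.trace ℤ_[ℓ] (Z.tateModule ℓ) (tateModuleMap ℓ (End.asHom (ρZ h))) *
          LinearMap.trace ℤ_[ℓ] (Y.tateModule ℓ) (tateModuleMap ℓ (End.asHom (α h⁻¹))) := by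
  -- `g ↦ χ_Z(g⁻¹)` is a class function
  have hc : ∀ g x : G, LinearMap.trace ℤ_[ℓ] (Z.tateModule ℓ) (tateModuleMap ℓ (End.asHom (ρZ (x⁻¹ * g * x)⁻¹))) =
      LinearMap.trace ℤ_[ℓ] (Z.tateModule ℓ) (tateModuleMap ℓ (End.asHom (ρZ g⁻¹))) := fun g x ↦ by
    rw [show (x⁻¹ * g * x)⁻¹ = x⁻¹ * g⁻¹ * x by group]
    exact trace_tateModuleMap_asHom_inv_mul_mul ℓ ρZ x g⁻¹
  have h1 := card_stabilizer_mul_sum_mul_trace_eq ℓ b ρ t₀ α hb hρ hℓ hα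
    (fun g ↦ LinearMap.trace ℤ_[ℓ] (Z.tateModule ℓ) (tateModuleMap ℓ (End.asHom (ρZ g⁻¹)))) hc
  -- reindex `g ↦ g⁻¹` on `G` and `h ↦ h⁻¹` on `H`
  have hG : ∑ g, LinearMap.trace ℤ_[ℓ] (Z.tateModule ℓ) (tateModuleMap ℓ (End.asHom (ρZ g))) *
        LinearMap.trace ℤ_[ℓ] (b.pt.tateModule ℓ) (tateModuleMap ℓ (End.asHom (ρ g⁻¹))) =
      ∑ g, LinearMap.trace ℤ_[ℓ] (Z.tateModule ℓ) (tateModuleMap ℓ (End.asHom (ρZ g⁻¹))) *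
        LinearMap.trace ℤ_[ℓ] (b.pt.tateModule ℓ) (tateModuleMap ℓ (End.asHom (ρ g))) :=
    Fintype.sum_equiv (Equiv.inv G) _ _ fun g ↦ by simp only [Equiv.inv_apply, inv_inv]
  have hH : ∑ h : stabilizer G t₀, LinearMap.trace ℤ_[ℓ] (Z.tateModule ℓ) (tateModuleMap ℓ (End.asHom (ρZ h))) *
        LinearMap.trace ℤ_[ℓ] (Y.tateModule ℓ) (tateModuleMap ℓ (End.asHom (α h⁻¹))) =
      ∑ h : stabilizer G t₀, LinearMap.trace ℤ_[ℓ] (Z.tateModule ℓ) (tateModuleMap ℓ (End.asHom (ρZ (h : G)⁻¹))) *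
        LinearMap.trace ℤ_[ℓ] (Y.tateModule ℓ) (tateModuleMap ℓ (End.asHom (α h))) :=
    Fintype.sum_equiv (Equiv.inv (stabilizer G t₀)) _ _ fun h ↦ by
      simp only [Equiv.inv_apply, inv_inv, InvMemClass.coe_inv]
  rw [hG, hH]
  exact h1

/-- **`rk_{ℤ_ℓ} Hom_{ℤ_ℓ[G]}(T_ℓ Ind_H^G Y, T_ℓ Z) = rk_{ℤ_ℓ} Hom_{ℤ_ℓ[H]}(T_ℓ Y, T_ℓ Res_H Z)`** — Frobenius reciprocity for
the `ℓ`-adic intertwining numbers (`|G| · rk Hom_{ℤ_ℓ[G]}(T_ℓ X, T_ℓ Z) = Σ_g χ_Z(g) χ_X(g⁻¹)`, the tree's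
`card_mul_finrank_equivariantTateHom_eq_sum`, on both sides of §1). [cite: SerreLinearRepresentations1977, §7.2 Thm. 13 and Remark (3)]
[cite: MumfordAV1970, §19 Thm. 3 (p. 176)] -/
theorem finrank_equivariantTateHom_induced_source_eq (hb : ∑ t, b.π t ≫ b.ι t = 𝟙 b.pt)
    (hρ : ∀ (g : G) (t u : T), g • t ≠ u → b.ι t ≫ End.asHom (ρ g) ≫ b.π u = 0) (hℓ : (ℓ : K) ≠ 0)
    (hα : ∀ h : stabilizer G t₀, End.asHom (α h) = b.ι t₀ ≫ End.asHom (ρ h) ≫ b.π t₀) :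
    Module.finrank ℤ_[ℓ]
        (⨅ g : G, LinearMap.eqLocus (LinearMap.llcomp ℤ_[ℓ] _ _ _ (tateModuleMap ℓ (End.asHom (ρZ g))))
          (LinearMap.lcomp ℤ_[ℓ] _ (tateModuleMap ℓ (End.asHom (ρ g)))) :
            Submodule ℤ_[ℓ] (b.pt.tateModule ℓ →ₗ[ℤ_[ℓ]] Z.tateModule ℓ)) =
      Module.finrank ℤ_[ℓ]
        (⨅ h : stabilizer G t₀, LinearMap.eqLocus
          (LinearMap.llcomp ℤ_[ℓ] _ _ _ (tateModuleMap ℓ (End.asHom ((ρZ.comp (stabilizer G t₀).subtype) h))))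
          (LinearMap.lcomp ℤ_[ℓ] _ (tateModuleMap ℓ (End.asHom (α h)))) :
            Submodule ℤ_[ℓ] (Y.tateModule ℓ →ₗ[ℤ_[ℓ]] Z.tateModule ℓ)) := by
  have hG := card_mul_finrank_equivariantTateHom_eq_sum ℓ ρ ρZ hℓ
  have hH : (Fintype.card (stabilizer G t₀) : ℤ_[ℓ]) * Module.finrank ℤ_[ℓ]
      (⨅ h : stabilizer G t₀, LinearMap.eqLocus
        (LinearMap.llcomp ℤ_[ℓ] _ _ _ (tateModuleMap ℓ (End.asHom ((ρZ.comp (stabilizer G t₀).subtype) h))))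
        (LinearMap.lcomp ℤ_[ℓ] _ (tateModuleMap ℓ (End.asHom (α h)))) :
          Submodule ℤ_[ℓ] (Y.tateModule ℓ →ₗ[ℤ_[ℓ]] Z.tateModule ℓ)) =
      ∑ h : stabilizer G t₀, LinearMap.trace ℤ_[ℓ] (Z.tateModule ℓ) (tateModuleMap ℓ (End.asHom (ρZ h))) *
        LinearMap.trace ℤ_[ℓ] (Y.tateModule ℓ) (tateModuleMap ℓ (End.asHom (α h⁻¹))) :=
    card_mul_finrank_equivariantTateHom_eq_sum ℓ α (ρZ.comp (stabilizer G t₀).subtype) hℓ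
  have h := card_stabilizer_mul_sum_trace_mul_trace_inv_eq ℓ b ρ ρZ t₀ α hb hρ hℓ hα
  rw [← hG, ← hH, ← mul_assoc, ← mul_assoc,
    mul_comm (Fintype.card G : ℤ_[ℓ]) (Fintype.card (stabilizer G t₀) : ℤ_[ℓ])] at h
  exact_mod_cast mul_left_cancel₀ (mul_ne_zero (Nat.cast_ne_zero.2 Fintype.card_ne_zero)
    (Nat.cast_ne_zero.2 Fintype.card_ne_zero)) h

/-- **`rk_{ℤ_ℓ} Hom_{ℤ_ℓ[G]}(T_ℓ Z, T_ℓ Ind_H^G Y) = rk_{ℤ_ℓ} Hom_{ℤ_ℓ[H]}(T_ℓ Res_H Z, T_ℓ Y)`** (the induced module is also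
co-induced: `⟨χ_Z, Ind χ_Y⟩_G = ⟨Res χ_Z, χ_Y⟩_H`). [cite: SerreLinearRepresentations1977, §7.2 Thm. 13 and §7.1 Remark (2)]
[cite: MumfordAV1970, §19 Thm. 3 (p. 176)] -/
theorem finrank_equivariantTateHom_induced_target_eq (hb : ∑ t, b.π t ≫ b.ι t = 𝟙 b.pt)
    (hρ : ∀ (g : G) (t u : T), g • t ≠ u → b.ι t ≫ End.asHom (ρ g) ≫ b.π u = 0) (hℓ : (ℓ : K) ≠ 0)
    (hα : ∀ h : stabilizer G t₀, End.asHom (α h) = b.ι t₀ ≫ End.asHom (ρ h) ≫ b.π t₀) :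
    Module.finrank ℤ_[ℓ]
        (⨅ g : G, LinearMap.eqLocus (LinearMap.llcomp ℤ_[ℓ] _ _ _ (tateModuleMap ℓ (End.asHom (ρ g))))
          (LinearMap.lcomp ℤ_[ℓ] _ (tateModuleMap ℓ (End.asHom (ρZ g)))) :
            Submodule ℤ_[ℓ] (Z.tateModule ℓ →ₗ[ℤ_[ℓ]] b.pt.tateModule ℓ)) =
      Module.finrank ℤ_[ℓ]
        (⨅ h : stabilizer G t₀, LinearMap.eqLocus
          (LinearMap.llcomp ℤ_[ℓ] _ _ _ (tateModuleMap ℓ (End.asHom (α h))))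
          (LinearMap.lcomp ℤ_[ℓ] _ (tateModuleMap ℓ (End.asHom ((ρZ.comp (stabilizer G t₀).subtype) h)))) :
            Submodule ℤ_[ℓ] (Z.tateModule ℓ →ₗ[ℤ_[ℓ]] Y.tateModule ℓ)) := by
  have hG := card_mul_finrank_equivariantTateHom_eq_sum ℓ ρZ ρ hℓ
  have hH : (Fintype.card (stabilizer G t₀) : ℤ_[ℓ]) * Module.finrank ℤ_[ℓ]
      (⨅ h : stabilizer G t₀, LinearMap.eqLocus
        (LinearMap.llcomp ℤ_[ℓ] _ _ _ (tateModuleMap ℓ (End.asHom (α h))))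
        (LinearMap.lcomp ℤ_[ℓ] _ (tateModuleMap ℓ (End.asHom ((ρZ.comp (stabilizer G t₀).subtype) h)))) :
          Submodule ℤ_[ℓ] (Z.tateModule ℓ →ₗ[ℤ_[ℓ]] Y.tateModule ℓ)) =
      ∑ h : stabilizer G t₀, LinearMap.trace ℤ_[ℓ] (Y.tateModule ℓ) (tateModuleMap ℓ (End.asHom (α h))) *
        LinearMap.trace ℤ_[ℓ] (Z.tateModule ℓ) (tateModuleMap ℓ (End.asHom (ρZ (h : G)⁻¹))) :=
    card_mul_finrank_equivariantTateHom_eq_sum ℓ (ρZ.comp (stabilizer G t₀).subtype) α hℓ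
  have h := card_stabilizer_mul_sum_trace_mul_trace_inv_eq ℓ b ρ ρZ t₀ α hb hρ hℓ hα
  -- rewrite both sums of `h` in the "target" form by `g ↦ g⁻¹`, `h ↦ h⁻¹`
  have eG : ∑ g, LinearMap.trace ℤ_[ℓ] (Z.tateModule ℓ) (tateModuleMap ℓ (End.asHom (ρZ g))) *
        LinearMap.trace ℤ_[ℓ] (b.pt.tateModule ℓ) (tateModuleMap ℓ (End.asHom (ρ g⁻¹))) =
      ∑ g, LinearMap.trace ℤ_[ℓ] (b.pt.tateModule ℓ) (tateModuleMap ℓ (End.asHom (ρ g))) *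
        LinearMap.trace ℤ_[ℓ] (Z.tateModule ℓ) (tateModuleMap ℓ (End.asHom (ρZ g⁻¹))) :=
    Fintype.sum_equiv (Equiv.inv G) _ _ fun g ↦ by simp only [Equiv.inv_apply, inv_inv, mul_comm]
  have eH : ∑ h : stabilizer G t₀, LinearMap.trace ℤ_[ℓ] (Z.tateModule ℓ) (tateModuleMap ℓ (End.asHom (ρZ h))) *
        LinearMap.trace ℤ_[ℓ] (Y.tateModule ℓ) (tateModuleMap ℓ (End.asHom (α h⁻¹))) =
      ∑ h : stabilizer G t₀, LinearMap.trace ℤ_[ℓ] (Y.tateModule ℓ) (tateModuleMap ℓ (End.asHom (α h))) *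
        LinearMap.trace ℤ_[ℓ] (Z.tateModule ℓ) (tateModuleMap ℓ (End.asHom (ρZ (h : G)⁻¹))) :=
    Fintype.sum_equiv (Equiv.inv (stabilizer G t₀)) _ _ fun h ↦ by
      simp only [Equiv.inv_apply, inv_inv, InvMemClass.coe_inv, mul_comm]
  rw [eG, eH, ← hG, ← hH, ← mul_assoc, ← mul_assoc,
    mul_comm (Fintype.card G : ℤ_[ℓ]) (Fintype.card (stabilizer G t₀) : ℤ_[ℓ])] at h
  exact_mod_cast mul_left_cancel₀ (mul_ne_zero (Nat.cast_ne_zero.2 Fintype.card_ne_zero)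
    (Nat.cast_ne_zero.2 Fintype.card_ne_zero)) h

end Reciprocity

/-! ## §2 Mackey's intertwining formula for two induced actions and Prop. 23's `⟨V, V⟩_G = Σ_s d_s` -/

section Mackey

variable (ℓ : ℕ) [Fact ℓ.Prime] {Y Y' : AbelianVariety K} {T T' : Type} [Fintype T] [Fintype T'] [DecidableEq T]
  (b : Bicone (fun _ : T ↦ Y)) (b' : Bicone (fun _ : T' ↦ Y')) {G : Type} [Group G] [Fintype G]
  [MulAction G T] [IsPretransitive G T] [MulAction G T'] [IsPretransitive G T']
  (ρ : G →* End b.pt) (ρ' : G →* End b'.pt) (t₀ : T) (t₀' : T') [Fintype (stabilizer G t₀)]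
  [Fintype (stabilizer G t₀')] (α : stabilizer G t₀ →* End Y) (α' : stabilizer G t₀' →* End Y')

/-- **Mackey's intertwining formula, `ℓ`-adic form**: for two induced actions `X = Ind_H^G (Y, α)` (over `T ∋ t₀`) and
`X' = Ind_{H'}^G (Y', α')` (over `T' ∋ t₀'`),
**`|H| · |H'| · Σ_{g ∈ G} χ_{X'}(g) χ_X(g⁻¹) = |G| · Σ_{x ∈ G} Σ_{h' ∈ H', (xh'x⁻¹) t₀ = t₀} Tr(ι_{t₀} ρ(x h'⁻¹ x⁻¹) π_{t₀} | T_ℓ Y) · Tr(α'(h') | T_ℓ Y')`**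
— Frobenius reciprocity (§1 with `Z = X'`) followed by the Mackey formula for `Res_H X'` (the prequel, weight
`g ↦ [g t₀ = t₀] χ_Y(g⁻¹)`): `⟨Ind χ_Y, Ind χ_{Y'}⟩_G = Σ_{s ∈ H\G/H'} ⟨ρ^s|, ρ'|⟩_{H' ∩ s⁻¹Hs}` in summed-over-`G` form.
[cite: SerreLinearRepresentations1977, §7.4 Prop. 23 (proof) and §7.3 Prop. 22] [cite: SerreLinearRepresentations1977, §7.2 Thm. 13] -/
theorem card_stabilizers_mul_sum_trace_mul_trace_inv_eq (hb : ∑ t, b.π t ≫ b.ι t = 𝟙 b.pt)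
    (hρ : ∀ (g : G) (t u : T), g • t ≠ u → b.ι t ≫ End.asHom (ρ g) ≫ b.π u = 0)
    (hb' : ∑ t, b'.π t ≫ b'.ι t = 𝟙 b'.pt)
    (hρ' : ∀ (g : G) (t u : T'), g • t ≠ u → b'.ι t ≫ End.asHom (ρ' g) ≫ b'.π u = 0) (hℓ : (ℓ : K) ≠ 0)
    (hα : ∀ h : stabilizer G t₀, End.asHom (α h) = b.ι t₀ ≫ End.asHom (ρ h) ≫ b.π t₀)
    (hα' : ∀ h : stabilizer G t₀', End.asHom (α' h) = b'.ι t₀' ≫ End.asHom (ρ' h) ≫ b'.π t₀') :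
    (Fintype.card (stabilizer G t₀) : ℤ_[ℓ]) * (Fintype.card (stabilizer G t₀') : ℤ_[ℓ]) *
        ∑ g, LinearMap.trace ℤ_[ℓ] (b'.pt.tateModule ℓ) (tateModuleMap ℓ (End.asHom (ρ' g))) *
          LinearMap.trace ℤ_[ℓ] (b.pt.tateModule ℓ) (tateModuleMap ℓ (End.asHom (ρ g⁻¹))) =
      (Fintype.card G : ℤ_[ℓ]) * ∑ x : G, ∑ h' : stabilizer G t₀', (if (x * h' * x⁻¹) • t₀ = t₀ then
        LinearMap.trace ℤ_[ℓ] (Y.tateModule ℓ) (tateModuleMap ℓ (b.ι t₀ ≫ End.asHom (ρ (x * (h' : G)⁻¹ * x⁻¹)) ≫ b.π t₀)) *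
          LinearMap.trace ℤ_[ℓ] (Y'.tateModule ℓ) (tateModuleMap ℓ (End.asHom (α' h'))) else 0) := by
  classical
  -- Frobenius reciprocity with `Z = X'`
  have h1 := card_stabilizer_mul_sum_trace_mul_trace_inv_eq ℓ b ρ ρ' t₀ α hb hρ hℓ hα
  -- Mackey for `Res_H X'` with the weight `c(g) = [g t₀ = t₀] Tr(ι_{t₀} ρ(g⁻¹) π_{t₀})`
  set c : G → ℤ_[ℓ] := fun g ↦ if g • t₀ = t₀ then
    LinearMap.trace ℤ_[ℓ] (Y.tateModule ℓ) (tateModuleMap ℓ (b.ι t₀ ≫ End.asHom (ρ g⁻¹) ≫ b.π t₀)) else 0 with hc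
  have h2 := card_stabilizer_mul_sum_subgroup_mul_trace_eq ℓ b' ρ' t₀' α' (stabilizer G t₀) hb' hρ' hℓ hα' c
  have h3 : ∑ h : stabilizer G t₀, c h *
        LinearMap.trace ℤ_[ℓ] (b'.pt.tateModule ℓ) (tateModuleMap ℓ (End.asHom (ρ' h))) =
      ∑ h : stabilizer G t₀, LinearMap.trace ℤ_[ℓ] (b'.pt.tateModule ℓ) (tateModuleMap ℓ (End.asHom (ρ' h))) *
        LinearMap.trace ℤ_[ℓ] (Y.tateModule ℓ) (tateModuleMap ℓ (End.asHom (α h⁻¹))) :=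
    Finset.sum_congr rfl fun h _ ↦ by
      simp only [hc, mem_stabilizer_iff.1 h.2, ↓reduceIte]
      rw [hα h⁻¹, InvMemClass.coe_inv, mul_comm]
  rw [h3] at h2
  calc (Fintype.card (stabilizer G t₀) : ℤ_[ℓ]) * (Fintype.card (stabilizer G t₀') : ℤ_[ℓ]) *
        ∑ g, LinearMap.trace ℤ_[ℓ] (b'.pt.tateModule ℓ) (tateModuleMap ℓ (End.asHom (ρ' g))) *
          LinearMap.trace ℤ_[ℓ] (b.pt.tateModule ℓ) (tateModuleMap ℓ (End.asHom (ρ g⁻¹)))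
      = (Fintype.card (stabilizer G t₀') : ℤ_[ℓ]) * ((Fintype.card (stabilizer G t₀) : ℤ_[ℓ]) *
        ∑ g, LinearMap.trace ℤ_[ℓ] (b'.pt.tateModule ℓ) (tateModuleMap ℓ (End.asHom (ρ' g))) *
          LinearMap.trace ℤ_[ℓ] (b.pt.tateModule ℓ) (tateModuleMap ℓ (End.asHom (ρ g⁻¹)))) := by ring
    _ = (Fintype.card G : ℤ_[ℓ]) * ((Fintype.card (stabilizer G t₀') : ℤ_[ℓ]) *
        ∑ h : stabilizer G t₀, LinearMap.trace ℤ_[ℓ] (b'.pt.tateModule ℓ) (tateModuleMap ℓ (End.asHom (ρ' h))) *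
          LinearMap.trace ℤ_[ℓ] (Y.tateModule ℓ) (tateModuleMap ℓ (End.asHom (α h⁻¹)))) := by rw [h1]; ring
    _ = (Fintype.card G : ℤ_[ℓ]) * ∑ x : G, ∑ h' : stabilizer G t₀', (if x * h' * x⁻¹ ∈ stabilizer G t₀ then
        c (x * h' * x⁻¹) * LinearMap.trace ℤ_[ℓ] (Y'.tateModule ℓ) (tateModuleMap ℓ (End.asHom (α' h'))) else 0) := by
        rw [h2]
    _ = (Fintype.card G : ℤ_[ℓ]) * ∑ x : G, ∑ h' : stabilizer G t₀', (if (x * h' * x⁻¹) • t₀ = t₀ then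
        LinearMap.trace ℤ_[ℓ] (Y.tateModule ℓ) (tateModuleMap ℓ (b.ι t₀ ≫ End.asHom (ρ (x * (h' : G)⁻¹ * x⁻¹)) ≫ b.π t₀)) *
          LinearMap.trace ℤ_[ℓ] (Y'.tateModule ℓ) (tateModuleMap ℓ (End.asHom (α' h'))) else 0) := by
        congr 1
        refine Finset.sum_congr rfl fun x _ ↦ Finset.sum_congr rfl fun h' _ ↦ ?_
        simp only [hc, mem_stabilizer_iff]
        split_ifs with hx
        · rw [show (x * (h' : G) * x⁻¹)⁻¹ = x * (h' : G)⁻¹ * x⁻¹ by group]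
        · rfl

/-- **`|H| · |H'| · rk_{ℤ_ℓ} Hom_{ℤ_ℓ[G]}(T_ℓ Ind_H^G Y, T_ℓ Ind_{H'}^G Y') = Σ_{x ∈ G} Σ_{h' ∈ H' ∩ x⁻¹Hx} χ_Y(x h'⁻¹ x⁻¹) χ_{Y'}(h')`**
(with `χ_Y(x h'⁻¹ x⁻¹) = Tr(ι_{t₀} ρ(x h'⁻¹ x⁻¹) π_{t₀} | T_ℓ Y)`): Mackey's formula for the `ℓ`-adic intertwining number of two
induced actions (`|G| · rk = Σ_g χ_{X'}(g) χ_X(g⁻¹)` and the preceding theorem).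
[cite: SerreLinearRepresentations1977, §7.4 Prop. 23 (proof) and §7.3 Prop. 22] [cite: MumfordAV1970, §19 Thm. 3 (p. 176)] -/
theorem card_stabilizers_mul_finrank_equivariantTateHom_eq_sum (hb : ∑ t, b.π t ≫ b.ι t = 𝟙 b.pt)
    (hρ : ∀ (g : G) (t u : T), g • t ≠ u → b.ι t ≫ End.asHom (ρ g) ≫ b.π u = 0)
    (hb' : ∑ t, b'.π t ≫ b'.ι t = 𝟙 b'.pt)
    (hρ' : ∀ (g : G) (t u : T'), g • t ≠ u → b'.ι t ≫ End.asHom (ρ' g) ≫ b'.π u = 0) (hℓ : (ℓ : K) ≠ 0)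
    (hα : ∀ h : stabilizer G t₀, End.asHom (α h) = b.ι t₀ ≫ End.asHom (ρ h) ≫ b.π t₀)
    (hα' : ∀ h : stabilizer G t₀', End.asHom (α' h) = b'.ι t₀' ≫ End.asHom (ρ' h) ≫ b'.π t₀') :
    (Fintype.card (stabilizer G t₀) : ℤ_[ℓ]) * (Fintype.card (stabilizer G t₀') : ℤ_[ℓ]) * Module.finrank ℤ_[ℓ]
        (⨅ g : G, LinearMap.eqLocus (LinearMap.llcomp ℤ_[ℓ] _ _ _ (tateModuleMap ℓ (End.asHom (ρ' g))))
          (LinearMap.lcomp ℤ_[ℓ] _ (tateModuleMap ℓ (End.asHom (ρ g)))) :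
            Submodule ℤ_[ℓ] (b.pt.tateModule ℓ →ₗ[ℤ_[ℓ]] b'.pt.tateModule ℓ)) =
      ∑ x : G, ∑ h' : stabilizer G t₀', (if (x * h' * x⁻¹) • t₀ = t₀ then
        LinearMap.trace ℤ_[ℓ] (Y.tateModule ℓ) (tateModuleMap ℓ (b.ι t₀ ≫ End.asHom (ρ (x * (h' : G)⁻¹ * x⁻¹)) ≫ b.π t₀)) *
          LinearMap.trace ℤ_[ℓ] (Y'.tateModule ℓ) (tateModuleMap ℓ (End.asHom (α' h'))) else 0) := by
  have h := card_stabilizers_mul_sum_trace_mul_trace_inv_eq ℓ b b' ρ ρ' t₀ t₀' α α' hb hρ hb' hρ' hℓ hα hα'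
  rw [← card_mul_finrank_equivariantTateHom_eq_sum ℓ ρ ρ' hℓ] at h
  refine mul_left_cancel₀ (Nat.cast_ne_zero.2 Fintype.card_ne_zero : (Fintype.card G : ℤ_[ℓ]) ≠ 0) ?_
  linear_combination h

end Mackey

section Prop23

variable (ℓ : ℕ) [Fact ℓ.Prime] {Y : AbelianVariety K} {T : Type} [Fintype T] [DecidableEq T]
  (b : Bicone (fun _ : T ↦ Y)) {G : Type} [Group G] [Fintype G] [MulAction G T] [IsPretransitive G T]
  (ρ : G →* End b.pt) (t₀ : T) [Fintype (stabilizer G t₀)] (α : stabilizer G t₀ →* End Y)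

/-- **Serre's Proposition 23 formula `⟨V, V⟩_G = Σ_{s ∈ H\G/H} d_s`, `ℓ`-adic form**:
**`|H|² · rk_{ℤ_ℓ} End_{ℤ_ℓ[G]}(T_ℓ Ind_H^G Y) = Σ_{x ∈ G} Σ_{h ∈ H ∩ x⁻¹Hx} χ_Y(x h⁻¹ x⁻¹) χ_Y(h)`**
(`d_s = ⟨Res_s ρ, ρ^s⟩_{H_s}`; the `x ∈ H` terms contribute `|H|² · rk End_{ℤ_ℓ[H]}(T_ℓ Y)`, `d_1 = ⟨ρ, ρ⟩`).  Mackey's criterion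
reads off this: `Ind_H^G W` is irreducible iff `W` is and `ρ^s`, `Res_s ρ` are disjoint for `s ∉ H`; the integral rank
`rk_ℤ End_G(Ind_H^G Y)` is bounded by the left side (`finrank_equivariantHom_le`). [cite: SerreLinearRepresentations1977, §7.4 Prop. 23 and Cor.]
[cite: MumfordAV1970, §19 Thm. 3 (p. 176)] -/
theorem card_stabilizer_sq_mul_finrank_equivariantTateEnd_eq_sum (hb : ∑ t, b.π t ≫ b.ι t = 𝟙 b.pt)
    (hρ : ∀ (g : G) (t u : T), g • t ≠ u → b.ι t ≫ End.asHom (ρ g) ≫ b.π u = 0) (hℓ : (ℓ : K) ≠ 0)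
    (hα : ∀ h : stabilizer G t₀, End.asHom (α h) = b.ι t₀ ≫ End.asHom (ρ h) ≫ b.π t₀) :
    (Fintype.card (stabilizer G t₀) : ℤ_[ℓ]) * (Fintype.card (stabilizer G t₀) : ℤ_[ℓ]) * Module.finrank ℤ_[ℓ]
        (⨅ g : G, LinearMap.eqLocus (LinearMap.llcomp ℤ_[ℓ] _ _ _ (tateModuleMap ℓ (End.asHom (ρ g))))
          (LinearMap.lcomp ℤ_[ℓ] _ (tateModuleMap ℓ (End.asHom (ρ g)))) :
            Submodule ℤ_[ℓ] (b.pt.tateModule ℓ →ₗ[ℤ_[ℓ]] b.pt.tateModule ℓ)) =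
      ∑ x : G, ∑ h : stabilizer G t₀, (if (x * h * x⁻¹) • t₀ = t₀ then
        LinearMap.trace ℤ_[ℓ] (Y.tateModule ℓ) (tateModuleMap ℓ (b.ι t₀ ≫ End.asHom (ρ (x * (h : G)⁻¹ * x⁻¹)) ≫ b.π t₀)) *
          LinearMap.trace ℤ_[ℓ] (Y.tateModule ℓ) (tateModuleMap ℓ (End.asHom (α h))) else 0) :=
  card_stabilizers_mul_finrank_equivariantTateHom_eq_sum ℓ b b ρ ρ t₀ t₀ α α hb hρ hb hρ hℓ hα hα

end Prop23

end Imprimitive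

end AbelianVariety

end Literature.AlgebraicGeometry.Motives
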